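import Summits.QuantumFields.YangMills.Theorems.FemtoTransferGapSlabRayleigh

/-! # Crux idea `block-endpoint` (crux-ideate #2, GEN 3, stmt-QuantumFields-20205 `LuscherReduction.DressedRitz`) — door clause (a) PROVED

The block-to-fine door `BlockToFine` of `Cruxes/DressedRitz/BlockEndpointSketch.lean` has three clauses; clause (a) — the JENSEN ROOT
`⟨ψ, K_β ψ⟩^ℓ ≤ ⟨ψ, K_β^ℓ ψ⟩ · ⟨ψ, ψ⟩^{ℓ-1}` (the fine Rayleigh quotient to the `ℓ`-th power is at most the block Rayleigh quotient) — is
proved here for EVERY physical test function `ψ`, every `β ≥ 0` and every block length `ℓ ≥ 1`, with no spectral theorem: only the two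
Cauchy–Schwarz inequalities of the tree (`sq_l2_le`, `sq_qform_le`), the symmetry `l2_iterate_iterate` and positivity `qform_su2Rep_self_nonneg`.

* `moment β ψ m = ⟨ψ, K_β^m ψ⟩`;  `moment_nonneg` (even moments are norms, odd moments are transfer forms);
* `moment_sq_le` — LOG-CONVEXITY `a_m² ≤ a_{m-1} a_{m+1}` (`m ≥ 1`; even `m` from the `K`-form Cauchy–Schwarz, odd `m` from the `L²` one);
* `moment_succ_mul_le` — division-free ratio monotonicity `a_m · a_1 ≤ a_{m+1} · a_0`;
* `jensen_root` — `a_1^ℓ ≤ a_ℓ · a_0^{ℓ-1}`;  `qform_pow_le` — the same in the tree's `qform ∕ l2 ∕ transferApply` currency = door clause (a)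
  (`blockCorr β ℓ 1 ψ ψ = l2 ψ (K_β^[1·ℓ] ψ)`), for any physical `ψ` (the door only needs it for once-dressed vectors).

HONEST FRAMING: femto-universe infrastructure (fixed lattice, pure transfer-operator algebra); nothing here bears on infinite volume or the
Clay gap.  [cite: ReedSimonIV1978, Thm. XIII.1] [folklore: log-convexity of moment sequences of a positive operator] -/

set_option autoImplicit false

noncomputable section

open MeasureTheory
open Literature.MathematicalPhysics.QuantumFieldTheory
open Literature.MathematicalPhysics.QuantumLattice
open Literature.Analysis.OperatorTheory.YMMatrixModel
open Summit.QuantumFields.YangMills.Theorems.FemtoTransferGap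

namespace Summit.QuantumFields.YangMills.Cruxes.DressedRitz.BlockEndpoint

variable {L : ℕ} [NeZero L]

/-- The `m`-th moment `a_m(ψ) = ⟨ψ, K_β^m ψ⟩` of the spectral measure of `ψ`. [folklore] -/
def moment (β : ℝ) (ψ : GaugeConfig 3 L SU2 → ℝ) (m : ℕ) : ℝ :=
  l2 ψ ((transferApply (L := L) β)^[m] ψ)

theorem moment_zero (β : ℝ) (ψ : GaugeConfig 3 L SU2 → ℝ) : moment β ψ 0 = l2 ψ ψ := by
  simp [moment]

theorem moment_one (β : ℝ) (ψ : GaugeConfig 3 L SU2 → ℝ) : moment β ψ 1 = qform su2Rep β ψ ψ := by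
  simp [moment, qform_eq_l2_transferApply]

/-- `⟨K^i ψ, K^j ψ⟩ = a_{i+j}(ψ)`. [folklore] -/
theorem l2_iterate_eq_moment (β : ℝ) {ψ : GaugeConfig 3 L SU2 → ℝ} (hψ : IsPhys ψ) (i j : ℕ) :
    l2 ((transferApply (L := L) β)^[i] ψ) ((transferApply β)^[j] ψ) = moment β ψ (i + j) :=
  l2_iterate_iterate β hψ i j

/-- `⟨K^i ψ, K (K^j ψ)⟩ = a_{i+j+1}(ψ)` — the transfer form of two iterates. [folklore] -/
theorem qform_iterate_eq_moment (β : ℝ) {ψ : GaugeConfig 3 L SU2 → ℝ} (hψ : IsPhys ψ) (i j : ℕ) :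
    qform su2Rep β ((transferApply (L := L) β)^[i] ψ) ((transferApply β)^[j] ψ) = moment β ψ (i + j + 1) := by
  rw [qform_eq_l2_transferApply, ← Function.iterate_succ_apply' (transferApply β) j ψ, l2_iterate_eq_moment β hψ]
  rfl

/-- All moments are non-negative (`β ≥ 0`): even ones are squared norms, odd ones are transfer forms of an iterate. [folklore] -/
theorem moment_nonneg {β : ℝ} (hβ : 0 ≤ β) {ψ : GaugeConfig 3 L SU2 → ℝ} (hψ : IsPhys ψ) (m : ℕ) : 0 ≤ moment β ψ m := by
  rcases Nat.even_or_odd m with ⟨j, rfl⟩ | ⟨j, rfl⟩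
  · rw [← l2_iterate_eq_moment β hψ j j]
    exact l2_self_nonneg _
  · have h := qform_su2Rep_self_nonneg hβ (isPhys_iterate_transferApply (L := L) β hψ j)
    rw [qform_iterate_eq_moment β hψ] at h
    have e : 2 * j + 1 = j + j + 1 := by ring
    rw [e]; exact h

/-- **Log-convexity of the moment sequence**: `a_m² ≤ a_{m-1} · a_{m+1}` for `m ≥ 1`. [folklore] -/
theorem moment_sq_le {β : ℝ} (hβ : 0 ≤ β) {ψ : GaugeConfig 3 L SU2 → ℝ} (hψ : IsPhys ψ) (m : ℕ) (hm : 1 ≤ m) :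
    moment β ψ m ^ 2 ≤ moment β ψ (m - 1) * moment β ψ (m + 1) := by
  rcases Nat.even_or_odd m with ⟨j, hj⟩ | ⟨j, hj⟩
  · -- even `m = j + j`, `j = i + 1`: the `K`-form Cauchy–Schwarz with `f = K^i ψ`, `g = K^{i+1} ψ`
    obtain ⟨i, rfl⟩ : ∃ i, j = i + 1 := ⟨j - 1, by omega⟩
    subst hj
    have hf := isPhys_iterate_transferApply (L := L) β hψ i
    have hg := isPhys_iterate_transferApply (L := L) β hψ (i + 1)
    have h := sq_qform_le hβ hf hg
    rw [qform_iterate_eq_moment β hψ, qform_iterate_eq_moment β hψ, qform_iterate_eq_moment β hψ] at h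
    convert h using 3 <;> omega
  · -- odd `m = 2j+1`: the `L²` Cauchy–Schwarz with `f = K^j ψ`, `g = K^{j+1} ψ`
    subst hj
    have hf := isPhys_iterate_transferApply (L := L) β hψ j
    have hg := isPhys_iterate_transferApply (L := L) β hψ (j + 1)
    have h := sq_l2_le hf hg
    rw [l2_iterate_eq_moment β hψ, l2_iterate_eq_moment β hψ, l2_iterate_eq_moment β hψ] at h
    convert h using 3 <;> omega

/-- **Ratio monotonicity (division-free)**: `a_m · a_1 ≤ a_{m+1} · a_0`, i.e. `a_{m+1}/a_m ≥ a_1/a_0`. [folklore] -/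
theorem moment_succ_mul_le {β : ℝ} (hβ : 0 ≤ β) {ψ : GaugeConfig 3 L SU2 → ℝ} (hψ : IsPhys ψ) (m : ℕ) :
    moment β ψ m * moment β ψ 1 ≤ moment β ψ (m + 1) * moment β ψ 0 := by
  induction m with
  | zero => rw [mul_comm]
  | succ m ih =>
    have lc := moment_sq_le hβ hψ (m + 1) (by omega)
    simp only [Nat.add_sub_cancel] at lc
    have h0 := moment_nonneg hβ hψ 0
    have h1 := moment_nonneg hβ hψ 1
    have hm1 := moment_nonneg hβ hψ (m + 1)
    have hm2 := moment_nonneg hβ hψ (m + 1 + 1)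
    rcases hm1.lt_or_eq with hpos | hzero
    · have key : moment β ψ (m + 1) * (moment β ψ (m + 1) * moment β ψ 1)
          ≤ moment β ψ (m + 1) * (moment β ψ (m + 1 + 1) * moment β ψ 0) := by
        calc moment β ψ (m + 1) * (moment β ψ (m + 1) * moment β ψ 1)
            = moment β ψ (m + 1) ^ 2 * moment β ψ 1 := by ring
          _ ≤ (moment β ψ m * moment β ψ (m + 1 + 1)) * moment β ψ 1 := mul_le_mul_of_nonneg_right lc h1
          _ = (moment β ψ m * moment β ψ 1) * moment β ψ (m + 1 + 1) := by ring
          _ ≤ (moment β ψ (m + 1) * moment β ψ 0) * moment β ψ (m + 1 + 1) := mul_le_mul_of_nonneg_right ih hm2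
          _ = moment β ψ (m + 1) * (moment β ψ (m + 1 + 1) * moment β ψ 0) := by ring
      exact le_of_mul_le_mul_left key hpos
    · rw [← hzero, zero_mul]
      exact mul_nonneg hm2 h0

/-- **Jensen root** (door clause (a), moment form): `a_1^ℓ ≤ a_ℓ · a_0^{ℓ-1}` for `ℓ ≥ 1`. [folklore] -/
theorem jensen_root {β : ℝ} (hβ : 0 ≤ β) {ψ : GaugeConfig 3 L SU2 → ℝ} (hψ : IsPhys ψ) (ℓ : ℕ) (hℓ : 1 ≤ ℓ) :
    moment β ψ 1 ^ ℓ ≤ moment β ψ ℓ * moment β ψ 0 ^ (ℓ - 1) := by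
  induction ℓ, hℓ using Nat.le_induction with
  | base => simp
  | succ n hn ih =>
    have h0 := moment_nonneg hβ hψ 0
    have h1 := moment_nonneg hβ hψ 1
    calc moment β ψ 1 ^ (n + 1) = moment β ψ 1 ^ n * moment β ψ 1 := pow_succ _ _
      _ ≤ (moment β ψ n * moment β ψ 0 ^ (n - 1)) * moment β ψ 1 := mul_le_mul_of_nonneg_right ih h1
      _ = (moment β ψ n * moment β ψ 1) * moment β ψ 0 ^ (n - 1) := by ring
      _ ≤ (moment β ψ (n + 1) * moment β ψ 0) * moment β ψ 0 ^ (n - 1) :=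
          mul_le_mul_of_nonneg_right (moment_succ_mul_le hβ hψ n) (pow_nonneg h0 _)
      _ = moment β ψ (n + 1) * moment β ψ 0 ^ (n + 1 - 1) := by
          rw [show n + 1 - 1 = (n - 1) + 1 from by omega, pow_succ]; ring

/-- **Door clause (a) in the tree's currency**: for every physical `ψ`, `β ≥ 0`, `ℓ ≥ 1`,
`⟨ψ, K_β ψ⟩^ℓ ≤ ⟨ψ, K_β^ℓ ψ⟩ · ⟨ψ, ψ⟩^{ℓ-1}` — the fine Rayleigh quotient to the `ℓ`-th power is at most the block Rayleigh quotient.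
[cite: ReedSimonIV1978, Thm. XIII.1] -/
theorem qform_pow_le {β : ℝ} (hβ : 0 ≤ β) {ψ : GaugeConfig 3 L SU2 → ℝ} (hψ : IsPhys ψ) (ℓ : ℕ) (hℓ : 1 ≤ ℓ) :
    qform su2Rep β ψ ψ ^ ℓ ≤ l2 ψ ((transferApply (L := L) β)^[ℓ] ψ) * l2 ψ ψ ^ (ℓ - 1) := by
  have h := jensen_root hβ hψ ℓ hℓ
  rw [moment_one, moment_zero] at h
  exact h

/-- The same with the block written as `K^[1·ℓ]` (literally the shape of `BlockToFine` (a): `blockCorr β ℓ 1 ψ ψ = l2 ψ (K^[1*ℓ] ψ)`). -/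
theorem qform_pow_le_block {β : ℝ} (hβ : 0 ≤ β) {ψ : GaugeConfig 3 L SU2 → ℝ} (hψ : IsPhys ψ) (ℓ : ℕ) (hℓ : 1 ≤ ℓ) :
    qform su2Rep β ψ ψ ^ ℓ ≤ l2 ψ ((transferApply (L := L) β)^[1 * ℓ] ψ) * l2 ψ ψ ^ (ℓ - 1) := by
  rw [one_mul]; exact qform_pow_le hβ hψ ℓ hℓ

end Summit.QuantumFields.YangMills.Cruxes.DressedRitz.BlockEndpoint
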